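import Summits.MatrixMultiplication.MatrixMultiplication.Theorems.ObstructionDescentUniversalOccurrenceTwoRectangleFloor
import Literature.Computability.AlgebraicComplexity.PlethysmStability

set_option linter.dupNamespace false
set_option autoImplicit false

/-!
# Universal occurrence — two rectangles and a HOOK, part A: twisted block structures and twin columns (decomp-mm · lens 3 · gen 43)

Route `route-MatrixMultiplication-ObstructionDescent` (sub-problem `MatrixMultiplication`, `ω(ℂ) = 2`); SUPPORT for the crux
`NoOccurrenceObstruction` (`P_O`, item `stmt-MatrixMultiplication-29040`) through the universal-occurrence programme (NODE-g29…g43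
of the decomp-mm cell, lens 3).  Nothing here proves `ω = 2` or closes an item; no `def`, no `sorry`, standard axioms.  Closure
currency as in parts I–IX: "the triple `(λ⁰,λ¹,λ²)` occurs for `s`" is `isotypicSum₁ λ⁰ (isotypicSum₂ λ¹ (isotypicSum₃ λ² (s^{⊗d}))) ≠ 0`.

**Why (critic g21 on g42, ask (2): "a uniform-in-`N` occurrence family BEYOND the Chow sector").**  Part IX (the floor law,
`occurs_unitTensor_twoRectangle_of_pairing_ne_zero`) reduces the occurrence of `((δ^N),(δ^N),ν)` in `⟨m⟩`, `m ≥ N`, to the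
non-vanishing of ONE explicit finite sum `∑_{σ ∈ S_N^δ} sgn(σ) ζ_{e'}(w_σ) ∑_w M(w) ∏_q c_{w_σ(q),w(q)}` (`M` a highest-weight vector
of weight `ν`, `e, e'` block structures).  With `e' = e` the sum factors through `Sym^N(Sym^δ ℂ^N)` (Chow sector): for `δ = 2` only
third legs with at most two rows.  Parts A–E (this series) evaluate the sum for `δ = 2` with a TWISTED `e' ≠ e` and prove, uniformly
in `N`, that the hook family `((2^N),(2^N),(2N-2j,2^j))`, `j ≤ 3`, occurs for `⟨m⟩`, `m ≥ N ≥ j+1` (part E,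
`occurs_unitTensor_twoRectangle_doubleHook`; three- and four-row third legs in parts C, B).

**This file: the three general tools.**  §1 (`sum_mul_prod_indicator_eq`): at the indicator matrix `c_g(i,l) = [l = g i]` of a
colouring `g` the inner sum collapses to the single word `g ∘ w_σ`.  §2 (`sign_mul_wordBlockSign_twist`): if `e'` is `e` with the
two blocks exchanged on the slots of `H ⊆ [N]`, then `sgn σ₀ · sgn σ₁ · ζ_{e'}(w_σ) = [σ₀⁻¹σ₁ stabilises H]` — the signs are
ABSORBED by the twist.  §3: for the column-reading tableau `T_h` of a doubled hook (two columns of height `h`, then a one-row arm;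
`hookCell_*`, `mem_youngDiagram_doubleHook`) a word in the support of the polytabloid `e_{T_h}` (tree: `StdFilling.polytabloid`)
vanishes on the arm and is injective with letters `< h` on each core column (`hookTableau_support`), and a word whose two core
columns read the SAME word ("twins") has `e_{T_h}(u) = sgn(ρ₀ · κρ₀κ) = 1` (`hookTableau_twin_eq_one`).  In parts B–D validity
`σ₀⁻¹σ₁(H) = H` plus support FORCES the twin property, so every summand of the floor-law sum is `0` or `1`.

[cite: BurgisserIkenmeyer2011, §3.4 (Prop. 3.4), Thm. 4.4] [cite: BurgisserIkenmeyer2017, §5, Thm. 5.9 (proof of (2)), eq. (3.4)]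
[cite: Landsberg2017, §9.1.1]
-/

noncomputable section

open scoped BigOperators

namespace Summit.MatrixMultiplication.MatrixMultiplication.Theorems.ObstructionCalculus

open Literature.Computability.AlgebraicComplexity
open Literature.NumberTheory.DiophantineGeometry

/-! ### §1 Collapse of the inner sum at an indicator matrix -/

/-- At the indicator matrix `c_g(i,l) = [l = g i]` the inner sum of the evaluation law collapses to one word:
`∑_w M(w) ∏_q [w q = g (v q)] = M (g ∘ v)`. [folklore] -/
theorem sum_mul_prod_indicator_eq {N D : ℕ} (M : Word N D → ℂ) (g : Fin N → Fin N) (v : Word N D) :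
    (∑ w : Word N D, M w * ∏ q, (if w q = g (v q) then (1 : ℂ) else 0)) = M (g ∘ v) := by
  classical
  rw [Finset.sum_eq_single (g ∘ v)]
  · simp
  · intro w _ hw
    obtain ⟨q, hq⟩ : ∃ q, w q ≠ g (v q) := by
      by_contra h
      push Not at h
      exact hw (funext h)
    rw [Finset.prod_eq_zero (Finset.mem_univ q) (if_neg hq), mul_zero]
  · intro h
    exact absurd (Finset.mem_univ _) h

/-! ### §2 Twisted block structures: the sign law -/

/-- **Sign law for a twisted pair of block structures.**  Let `e' ` be the block structure `e` with the two blocks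
exchanged on the slots of `H` (`e' q = (flip (e q).1, (e q).2)` iff `(e q).2 ∈ H`).  For the block word `w_σ` of `e`
(`σ = (σ₀, σ₁) ∈ S_N²`): `sgn σ₀ · sgn σ₁ · ζ_{e'}(w_σ) = [σ₀⁻¹ σ₁ stabilises H]`. [folklore] -/
theorem sign_mul_wordBlockSign_twist {N : ℕ} (e e' : Fin (N * 2) ≃ Fin 2 × Fin N) (H : Finset (Fin N))
    (he' : ∀ q, e' q = (if (e q).2 ∈ H then Fin.rev (e q).1 else (e q).1, (e q).2))
    (σ : Fin 2 → Equiv.Perm (Fin N)) :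
    (∏ a, ((Equiv.Perm.sign (σ a) : ℤ) : ℂ)) * wordBlockSign ℂ e' (fun q => σ (e q).1 (e q).2) =
      if ∀ s, (σ 0)⁻¹ (σ 1 s) ∈ H ↔ s ∈ H then 1 else 0 := by
  classical
  have r0 : Fin.rev (0 : Fin 2) = 1 := by decide
  have r1 : Fin.rev (1 : Fin 2) = 0 := by decide
  -- the block words of `w_σ` read through `e'`
  have hblk : ∀ (a : Fin 2) (j : Fin N),
      σ (e (e'.symm (a, j))).1 (e (e'.symm (a, j))).2 = if j ∈ H then σ (Fin.rev a) j else σ a j := by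
    intro a j
    have h1 : e' (e'.symm (a, j)) = (a, j) := e'.apply_symm_apply _
    rw [he'] at h1
    have h2 : (e (e'.symm (a, j))).2 = j := (Prod.ext_iff.1 h1).2
    have h3 := (Prod.ext_iff.1 h1).1
    simp only [h2] at h3
    rw [h2]
    by_cases hj : j ∈ H
    · rw [if_pos hj] at h3
      have h3' : (e (e'.symm (a, j))).1 = Fin.rev a := by
        have h4 := congrArg Fin.rev h3
        rwa [Fin.rev_rev] at h4
      rw [if_pos hj, h3']
    · rw [if_neg hj] at h3
      rw [if_neg hj, h3]
  set π : Equiv.Perm (Fin N) := (σ 0)⁻¹ * σ 1 with hπ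
  have hπs : ∀ s, π s = (σ 0)⁻¹ (σ 1 s) := fun s => rfl
  have hσ1 : σ 1 = σ 0 * π := by rw [hπ, mul_inv_cancel_left]
  have hinv : ∀ x, σ 0 ((σ 0)⁻¹ x) = x := fun x => (σ 0).apply_symm_apply x
  split_ifs with hval
  · -- valid: the twisted block words are the permutations `σ₀ κ_H`, `σ₀ κ_L`
    have hvalH : ∀ x, π x ∈ H ↔ x ∈ H := fun x => by rw [hπs]; exact hval x
    have hvalc : ∀ x, π x ∉ H ↔ x ∉ H := fun x => not_congr (hvalH x)
    set κH : Equiv.Perm (Fin N) := Equiv.Perm.ofSubtype (π.subtypePerm hvalH) with hκH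
    set κL : Equiv.Perm (Fin N) :=
      Equiv.Perm.ofSubtype (π.subtypePerm (p := fun x => x ∉ H) hvalc) with hκL
    have hκH_mem : ∀ x, x ∈ H → κH x = π x := fun x hx => by
      rw [hκH, Equiv.Perm.ofSubtype_apply_of_mem _ hx]
      rfl
    have hκH_nmem : ∀ x, x ∉ H → κH x = x := fun x hx =>
      Equiv.Perm.ofSubtype_apply_of_not_mem _ hx
    have hκL_mem : ∀ x, x ∉ H → κL x = π x := fun x hx => by
      rw [hκL, Equiv.Perm.ofSubtype_apply_of_mem (p := fun x => x ∉ H) _ hx]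
      rfl
    have hκL_nmem : ∀ x, x ∈ H → κL x = x := fun x hx =>
      Equiv.Perm.ofSubtype_apply_of_not_mem (p := fun x => x ∉ H) _ (not_not.2 hx)
    have hπκ : π = κH * κL := by
      ext x : 1
      show π x = κH (κL x)
      by_cases hx : x ∈ H
      · rw [hκL_nmem x hx, hκH_mem x hx]
      · rw [hκL_mem x hx, hκH_nmem _ ((hvalc x).2 hx)]
    set ω : Fin 2 → Equiv.Perm (Fin N) := ![σ 0 * κH, σ 0 * κL] with hω
    have hω0 : ω 0 = σ 0 * κH := rfl
    have hω1 : ω 1 = σ 0 * κL := rfl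
    have hword : (fun q => σ (e q).1 (e q).2) = fun q => ω (e' q).1 (e' q).2 := by
      funext q
      rw [he']
      rcases e q with ⟨a, s⟩
      dsimp only
      by_cases hs : s ∈ H
      · rw [if_pos hs]
        fin_cases a
        · show σ 0 s = ω (Fin.rev 0) s
          rw [r0, hω1, Equiv.Perm.mul_apply, hκL_nmem s hs]
        · show σ 1 s = ω (Fin.rev 1) s
          rw [r1, hω0, Equiv.Perm.mul_apply, hκH_mem s hs, hπs, hinv]
      · rw [if_neg hs]
        fin_cases a
        · show σ 0 s = ω 0 s
          rw [hω0, Equiv.Perm.mul_apply, hκH_nmem s hs]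
        · show σ 1 s = ω 1 s
          rw [hω1, Equiv.Perm.mul_apply, hκL_mem s hs, hπs, hinv]
    rw [hword, wordBlockSign_blockWord e' ω]
    simp only [Fin.prod_univ_two, hω0, hω1, hσ1, Equiv.Perm.sign_mul]
    rw [hπκ, Equiv.Perm.sign_mul]
    rcases Int.units_eq_one_or (Equiv.Perm.sign (σ 0)) with h0 | h0 <;>
    rcases Int.units_eq_one_or (Equiv.Perm.sign κH) with hH | hH <;>
    rcases Int.units_eq_one_or (Equiv.Perm.sign κL) with hL | hL <;>
    simp [h0, hH, hL]
  · -- invalid: a twisted block word repeats a letter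
    rw [wordBlockSign, if_neg, mul_zero]
    intro hbij
    apply hval
    intro s
    constructor
    · intro ht
      by_contra hs
      have h := hblk 1 ((σ 0)⁻¹ (σ 1 s))
      rw [if_pos ht, r1, hinv] at h
      have h' := hblk 1 s
      rw [if_neg hs] at h'
      have heq := (hbij 1).1 (h.trans h'.symm)
      exact hs (heq ▸ ht)
    · intro hs
      by_contra ht
      have h := hblk 0 ((σ 0)⁻¹ (σ 1 s))
      rw [if_neg ht, hinv] at h
      have h' := hblk 0 s
      rw [if_pos hs, r0] at h'
      have heq := (hbij 0).1 (h.trans h'.symm)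
      exact ht (heq.symm ▸ hs)


/-! ### §3 The hook tableaux `T_h`: two columns of height `h` read downwards, then a one-row arm -/

/-- Cells of `T_h` are distinct. [folklore] -/
theorem hookCell_injective (h : ℕ) {p q : ℕ}
    (hpq : (if p < h then (p, 0) else if p < 2 * h then (p - h, 1) else (0, p - 2 * h + 2) : ℕ × ℕ) =
      (if q < h then (q, 0) else if q < 2 * h then (q - h, 1) else (0, q - 2 * h + 2))) : p = q := by
  split_ifs at hpq <;> simp only [Prod.mk.injEq] at hpq <;> omega

/-- `T_h` is a standard filling for the position order. [folklore] -/
theorem hookCell_standard (h : ℕ) {p q : ℕ} (hpq : p < q) :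
    ¬ ((if q < h then (q, 0) else if q < 2 * h then (q - h, 1) else (0, q - 2 * h + 2) : ℕ × ℕ) ≤
      (if p < h then (p, 0) else if p < 2 * h then (p - h, 1) else (0, p - 2 * h + 2))) := by
  split_ifs <;> simp only [Prod.mk_le_mk] <;> omega

/-- The Young diagram of the doubled hook `(2N-2j, 2^j)`: its boxes. [folklore] -/
theorem mem_youngDiagram_doubleHook {N j : ℕ} (ν : Nat.Partition (N * 2))
    (hν : ν.sortedParts = (2 * N - 2 * j) :: List.replicate j 2) {r c : ℕ}
    (h : (r = 0 ∧ c < 2 * N - 2 * j) ∨ (1 ≤ r ∧ r ≤ j ∧ c < 2)) : (r, c) ∈ ν.youngDiagram := by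
  rw [Nat.Partition.mem_youngDiagram_iff, hν]
  rcases h with ⟨rfl, hc⟩ | ⟨hr1, hrj, hc⟩
  · exact ⟨by simp, by simpa using hc⟩
  · refine ⟨by simp; omega, ?_⟩
    obtain ⟨r', rfl⟩ : ∃ r', r = r' + 1 := ⟨r - 1, by omega⟩
    have hr' : r' < j := by omega
    simp [List.getElem_cons_succ, List.getElem_replicate, hc]

/-- The doubled hook has at most `j + 1` rows. [folklore] -/
theorem fst_lt_of_mem_youngDiagram_doubleHook {N j : ℕ} (ν : Nat.Partition (N * 2))
    (hν : ν.sortedParts = (2 * N - 2 * j) :: List.replicate j 2) {x : ℕ × ℕ}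
    (hx : x ∈ ν.youngDiagram.cells) : x.1 < j + 1 := by
  obtain ⟨h, -⟩ := (Nat.Partition.mem_youngDiagram_iff ν x).1 ((YoungDiagram.mem_cells _).1 hx)
  rw [hν] at h
  simpa using h

/-- The cells of `T_{j+1}` lie in the doubled hook `(2N-2j, 2^j)` (`j + 1 ≤ N`). [folklore] -/
theorem hookCell_mem_doubleHook {N j : ℕ} (hjN : j + 1 ≤ N) (ν : Nat.Partition (N * 2))
    (hν : ν.sortedParts = (2 * N - 2 * j) :: List.replicate j 2) (p : ℕ) (hp : p < N * 2) :
    (if p < j + 1 then (p, 0) else if p < 2 * (j + 1) then (p - (j + 1), 1) else (0, p - 2 * (j + 1) + 2)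
      : ℕ × ℕ) ∈ ν.youngDiagram := by
  split_ifs with h1 h2
  · apply mem_youngDiagram_doubleHook ν hν
    rcases Nat.eq_zero_or_pos p with rfl | hp0
    · left; constructor <;> omega
    · right; refine ⟨?_, ?_, ?_⟩ <;> omega
  · apply mem_youngDiagram_doubleHook ν hν
    rcases Nat.eq_zero_or_pos (p - (j + 1)) with h0 | hp0
    · left; constructor <;> omega
    · right; refine ⟨?_, ?_, ?_⟩ <;> omega
  · apply mem_youngDiagram_doubleHook ν hν
    left; constructor <;> omega

/-- **Support of the polytabloid of `T_h`.**  If `e_{T_h}(u) ≠ 0` then `u` vanishes on the arm, and on each of the two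
core columns `u` takes `h` distinct values `< h` (`u = w_T ∘ σ` for a column permutation `σ`). [folklore] -/
theorem hookTableau_support {N h : ℕ} {Y : YoungDiagram} (hN : ∀ x ∈ Y.cells, x.1 < N)
    (T : StdFilling (N * 2) Y)
    (hT : ∀ p : Fin (N * 2), T.1 p = (if (p : ℕ) < h then ((p : ℕ), 0)
      else if (p : ℕ) < 2 * h then ((p : ℕ) - h, 1) else (0, (p : ℕ) - 2 * h + 2)))
    {u : Word N (N * 2)} (hu : T.polytabloid ℂ hN u ≠ 0) :
    (∀ p : Fin (N * 2), 2 * h ≤ (p : ℕ) → ((u p : Fin N) : ℕ) = 0) ∧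
    (∀ p : Fin (N * 2), (p : ℕ) < 2 * h → ((u p : Fin N) : ℕ) < h) ∧
    (∀ p q : Fin (N * 2), (p : ℕ) < h → (q : ℕ) < h → u p = u q → p = q) ∧
    (∀ p q : Fin (N * 2), h ≤ (p : ℕ) → (p : ℕ) < 2 * h → h ≤ (q : ℕ) → (q : ℕ) < 2 * h →
      u p = u q → p = q) := by
  classical
  obtain ⟨σ, hσ, rfl⟩ := StdFilling.exists_of_polytabloid_apply_ne_zero hN T hu
  have hcol : ∀ p, (T.1 (σ p)).2 = (T.1 p).2 := StdFilling.mem_colStab.1 hσ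
  have hval : ∀ p, ((StdFilling.rowWord hN T ∘ ⇑σ) p : ℕ) = (T.1 (σ p)).1 := fun p => rfl
  have hrow' : ∀ q : Fin (N * 2), (T.1 q).1 =
      if (q : ℕ) < h then (q : ℕ) else if (q : ℕ) < 2 * h then (q : ℕ) - h else 0 := fun q => by
    rw [hT]; split_ifs <;> rfl
  have hcol' : ∀ q : Fin (N * 2), (T.1 q).2 =
      if (q : ℕ) < h then 0 else if (q : ℕ) < 2 * h then 1 else (q : ℕ) - 2 * h + 2 := fun q => by
    rw [hT]; split_ifs <;> rfl
  refine ⟨fun p hp => ?_, fun p hp => ?_, fun p q hp hq hpq => ?_, fun p q hp hp' hq hq' hpq => ?_⟩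
  · have hc := hcol p
    rw [hcol', hcol'] at hc
    rw [hval, hrow']
    split_ifs at hc ⊢ <;> omega
  · have hc := hcol p
    rw [hcol', hcol'] at hc
    rw [hval, hrow']
    split_ifs at hc ⊢ <;> omega
  · have hr : (T.1 (σ p)).1 = (T.1 (σ q)).1 := by
      rw [← hval, ← hval]; exact congrArg Fin.val hpq
    have hc : (T.1 (σ p)).2 = (T.1 (σ q)).2 := by
      rw [hcol, hcol, hcol', hcol', if_pos hp, if_pos hq]
    exact σ.injective (T.injective (Prod.ext hr hc))
  · have hr : (T.1 (σ p)).1 = (T.1 (σ q)).1 := by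
      rw [← hval, ← hval]; exact congrArg Fin.val hpq
    have hc : (T.1 (σ p)).2 = (T.1 (σ q)).2 := by
      rw [hcol, hcol, hcol', hcol', if_neg (by omega), if_pos hp', if_neg (by omega), if_pos hq']
    exact σ.injective (T.injective (Prod.ext hr hc))

/-- **Twin words evaluate to `1`.**  If `u` vanishes on the arm, is injective with values `< h` on the first core column,
and repeats the first column's word on the second (`u (p + h) = u p`), then `e_{T_h}(u) = 1`: `u = w_T ∘ ρ` for the
column permutation `ρ = ρ₀ · κ ρ₀ κ` (`ρ₀` on column `0`, `κ` the row-wise exchange of the two columns), whose sign is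
`sgn(ρ₀)² = 1`. [folklore] -/
theorem hookTableau_twin_eq_one {N h : ℕ} {Y : YoungDiagram} (hN : ∀ x ∈ Y.cells, x.1 < N)
    (T : StdFilling (N * 2) Y)
    (hT : ∀ p : Fin (N * 2), T.1 p = (if (p : ℕ) < h then ((p : ℕ), 0)
      else if (p : ℕ) < 2 * h then ((p : ℕ) - h, 1) else (0, (p : ℕ) - 2 * h + 2)))
    (hh : 2 * h ≤ N * 2) {u : Word N (N * 2)}
    (harm : ∀ p : Fin (N * 2), 2 * h ≤ (p : ℕ) → ((u p : Fin N) : ℕ) = 0)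
    (hlt : ∀ p : Fin (N * 2), (p : ℕ) < h → ((u p : Fin N) : ℕ) < h)
    (hinj : ∀ p q : Fin (N * 2), (p : ℕ) < h → (q : ℕ) < h → u p = u q → p = q)
    (htwin : ∀ (p : Fin (N * 2)) (hp : (p : ℕ) < h), u ⟨p + h, by omega⟩ = u p) :
    T.polytabloid ℂ hN u = 1 := by
  classical
  have hrow' : ∀ q : Fin (N * 2), (T.1 q).1 =
      if (q : ℕ) < h then (q : ℕ) else if (q : ℕ) < 2 * h then (q : ℕ) - h else 0 := fun q => by
    rw [hT]; split_ifs <;> rfl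
  have hcol' : ∀ q : Fin (N * 2), (T.1 q).2 =
      if (q : ℕ) < h then 0 else if (q : ℕ) < 2 * h then 1 else (q : ℕ) - 2 * h + 2 := fun q => by
    rw [hT]; split_ifs <;> rfl
  -- `ρ₀`: the permutation of column `0` realising `u` there
  let f₀ : {p : Fin (N * 2) // (p : ℕ) < h} → {p : Fin (N * 2) // (p : ℕ) < h} :=
    fun x => ⟨⟨((u x.1 : Fin N) : ℕ), by have := hlt x.1 x.2; omega⟩, hlt x.1 x.2⟩
  have hf₀ : Function.Injective f₀ := by
    rintro ⟨p, hp⟩ ⟨q, hq⟩ hpq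
    have h1 : ((u p : Fin N) : ℕ) = ((u q : Fin N) : ℕ) := by
      have := congrArg (fun x : {p : Fin (N * 2) // (p : ℕ) < h} => ((x.1 : Fin (N * 2)) : ℕ)) hpq
      simpa [f₀] using this
    exact Subtype.ext (hinj p q hp hq (Fin.ext h1))
  let F₀ : Equiv.Perm {p : Fin (N * 2) // (p : ℕ) < h} :=
    Equiv.ofBijective f₀ (Finite.injective_iff_bijective.1 hf₀)
  let ρ₀ : Equiv.Perm (Fin (N * 2)) := Equiv.Perm.ofSubtype F₀
  have hρ₀_lt : ∀ p : Fin (N * 2), (p : ℕ) < h → ((ρ₀ p : Fin (N * 2)) : ℕ) = ((u p : Fin N) : ℕ) := by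
    intro p hp
    show ((Equiv.Perm.ofSubtype F₀ p : Fin (N * 2)) : ℕ) = _
    rw [Equiv.Perm.ofSubtype_apply_of_mem F₀ hp]
    rfl
  have hρ₀_ge : ∀ p : Fin (N * 2), ¬ (p : ℕ) < h → ρ₀ p = p := fun p hp =>
    Equiv.Perm.ofSubtype_apply_of_not_mem F₀ hp
  -- `κ`: the row-wise exchange of the two core columns
  let kf : Fin (N * 2) → Fin (N * 2) := fun p =>
    if hp : (p : ℕ) < h then ⟨p + h, by omega⟩ else if (p : ℕ) < 2 * h then ⟨p - h, by omega⟩ else p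
  have hkf : ∀ p, ((kf p : Fin (N * 2)) : ℕ) =
      if (p : ℕ) < h then (p : ℕ) + h else if (p : ℕ) < 2 * h then (p : ℕ) - h else p := by
    intro p; simp only [kf]; split_ifs <;> rfl
  have hk : Function.Involutive kf := by
    intro p
    apply Fin.ext
    rw [hkf, hkf]
    split_ifs <;> omega
  let κ : Equiv.Perm (Fin (N * 2)) := Function.Involutive.toPerm kf hk
  have hκ : ∀ p, ((κ p : Fin (N * 2)) : ℕ) =
      if (p : ℕ) < h then (p : ℕ) + h else if (p : ℕ) < 2 * h then (p : ℕ) - h else p := hkf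
  let ρ : Equiv.Perm (Fin (N * 2)) := ρ₀ * (κ * ρ₀ * κ)
  have hρ : ∀ p, ρ p = ρ₀ (κ (ρ₀ (κ p))) := fun p => rfl
  -- values of `ρ`
  have hρ_lt : ∀ p : Fin (N * 2), (p : ℕ) < h → ((ρ p : Fin (N * 2)) : ℕ) = ((u p : Fin N) : ℕ) := by
    intro p hp
    have h1 : ((κ p : Fin (N * 2)) : ℕ) = p + h := by rw [hκ, if_pos hp]
    have h2 : ρ₀ (κ p) = κ p := hρ₀_ge _ (by omega)
    have h3 : κ (κ p) = p := hk p
    rw [hρ, h2, h3]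
    exact hρ₀_lt p hp
  have hρ_mid : ∀ (p : Fin (N * 2)) (hp : h ≤ (p : ℕ)) (hp' : (p : ℕ) < 2 * h),
      ((ρ p : Fin (N * 2)) : ℕ) = ((u ⟨p - h, by omega⟩ : Fin N) : ℕ) + h := by
    intro p hp hp'
    have h1 : ((κ p : Fin (N * 2)) : ℕ) = p - h := by rw [hκ, if_neg (by omega), if_pos hp']
    have h1' : κ p = ⟨p - h, by omega⟩ := Fin.ext h1
    have h2 : ((ρ₀ (κ p) : Fin (N * 2)) : ℕ) = ((u ⟨p - h, by omega⟩ : Fin N) : ℕ) := by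
      rw [h1']; exact hρ₀_lt _ (by simp; omega)
    have hu' : ((u ⟨p - h, by omega⟩ : Fin N) : ℕ) < h := hlt _ (by simp; omega)
    have h3 : ((κ (ρ₀ (κ p)) : Fin (N * 2)) : ℕ) = ((u ⟨p - h, by omega⟩ : Fin N) : ℕ) + h := by
      rw [hκ, h2, if_pos hu']
    have h4 : ρ₀ (κ (ρ₀ (κ p))) = κ (ρ₀ (κ p)) := hρ₀_ge _ (by rw [h3]; omega)
    rw [hρ, h4, h3]
  have hρ_ge : ∀ p : Fin (N * 2), 2 * h ≤ (p : ℕ) → ρ p = p := by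
    intro p hp
    have h1 : κ p = p := Fin.ext (by rw [hκ, if_neg (by omega), if_neg (by omega)])
    have h2 : ρ₀ p = p := hρ₀_ge _ (by omega)
    rw [hρ, h1, h2, h1, h2]
  -- `ρ` is a column permutation and `u = w_T ∘ ρ`
  have hρC : ρ ∈ T.colStab := by
    rw [StdFilling.mem_colStab]
    intro p
    rw [hcol', hcol']
    by_cases h1 : (p : ℕ) < h
    · have := hρ_lt p h1
      have := hlt p h1
      rw [if_pos h1, if_pos (by omega)]
    · by_cases h2 : (p : ℕ) < 2 * h
      · have := hρ_mid p (by omega) h2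
        have := hlt ⟨p - h, by omega⟩ (by simp; omega)
        rw [if_neg h1, if_pos h2, if_neg (by omega), if_pos (by omega)]
      · rw [hρ_ge p (by omega)]
  have hw : u = StdFilling.rowWord hN T ∘ ⇑ρ := by
    funext p
    apply Fin.ext
    show ((u p : Fin N) : ℕ) = (T.1 (ρ p)).1
    rw [hrow']
    by_cases h1 : (p : ℕ) < h
    · have e1 := hρ_lt p h1
      have := hlt p h1
      rw [if_pos (by omega), e1]
    · by_cases h2 : (p : ℕ) < 2 * h
      · have e1 := hρ_mid p (by omega) h2
        have := hlt ⟨p - h, by omega⟩ (by simp; omega)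
        rw [if_neg (by omega), if_pos (by omega), e1, Nat.add_sub_cancel]
        have e2 := htwin ⟨p - h, by omega⟩ (by simp; omega)
        have e3 : (⟨((⟨(p : ℕ) - h, by omega⟩ : Fin (N * 2)) : ℕ) + h, by simp; omega⟩ : Fin (N * 2)) = p :=
          Fin.ext (by simp; omega)
        rw [e3] at e2
        rw [e2]
      · rw [hρ_ge p (by omega), if_neg h1, if_neg h2]
        exact harm p (by omega)
  have key := congrFun (StdFilling.wordPerm_polytabloid_of_mem_colStab (k := ℂ) hN T hρC)
    (StdFilling.rowWord hN T)
  rw [wordPerm_apply, ← hw, Pi.smul_apply, StdFilling.polytabloid_apply_rowWord, smul_eq_mul,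
    mul_one] at key
  rw [key]
  have hs : Equiv.Perm.sign ρ = 1 := by
    show Equiv.Perm.sign (ρ₀ * (κ * ρ₀ * κ)) = 1
    simp only [Equiv.Perm.sign_mul]
    rcases Int.units_eq_one_or (Equiv.Perm.sign ρ₀) with h1 | h1 <;>
    rcases Int.units_eq_one_or (Equiv.Perm.sign κ) with h2 | h2 <;> simp [h1, h2]
  rw [hs]
  simp

end Summit.MatrixMultiplication.MatrixMultiplication.Theorems.ObstructionCalculus
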